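import Summits.QuantumFields.BalabanUV.Beta.GAN24.StepResolventLegCharges
import Summits.QuantumFields.BalabanUV.Beta.TameKernelCalculus
import Literature.MathematicalPhysics.QuantumFieldTheory.Balaban1983to89.Beta.BalabanStepW2

/-!
# `BalabanUV.Beta.GAN24.ExchangeReadout` — row G-an2-4 ∕ (CONV-C), W-slot, SKELETON-W3 §7.2 zero-mode calculus, «W3-S3C*» PART 5 (addendum):
# THE COARSE `mm`-READ-OUT OF an2's SECOND RESPONSE-DERIVATIVE `K3OfK K N S M W b b′` — the two exchange trees and the `K·W·K` term —
# COLLAPSES ONTO THE SITE-FREE COARSE-LEG CHARGES OF `K`: three field–field double-leg sums survive and nothing else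

NOT IN PRINT; OUR PROOF ATTEMPT (idle-seat kernel lemma, unit `b2b-balaban-gan24-formalise-leaf-06`, gen 8; sandwich family PART 2a∕4 continued).
HONEST FRAMING (cell contract, verbatim): «discharging `BetaPertH` makes Bałaban's UV stability UNCONDITIONAL — a real constructive-QFT result; it is NOT
the continuum limit and NOT the Clay problem.»  HONEST DEPENDENCY (verbatim): «continuum YM on T⁴ ⇐ BetaPertH ∧ nine spine estimates (0/9 proved); BetaPertH
⇐ (D1) ∧ (D4) ∧ CAP+tail; G-an2-4 gates asym, D1 and NE2/3/4.»

WHAT ([folklore]; generic `d`, generic blocking `N ≥ 1`, generic decaying `K` with site-free coarse-leg charges; 0 `def`, 0 cite, 0 sorry):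
* §1 `exchange_eq_sandwich`: `(K∘P)∘((K∘Q)∘K) = (K∘((P∘K)∘Q))∘K` for a spread `K` and localised `P, Q` (an5's `TameKernelCalculus.comp_assoc_tame`,
  three times); hence **`hasSum_exchange_readout`**: the `mm`-entries of the EXCHANGE TREE `K∘P∘K∘Q∘K` read at the coarse points have the double-leg
  `HasSum` `Σ'_{(y,w)} Σ_{f,g} ρL f · ((P∘K)∘Q) y w f g · ρR g` (PART 2a `ResolventLegCharges.hasSum_sandwich_readout` with `V := (P∘K)∘Q`);
* §2 **`hasSum_mmRead_K3OfK`**: for an2's `BalabanStepW2.K3OfK K N S M W μ y ν y′ = −K·dM_b·K2OfK_{b′} − K·dM_{b′}·K2OfK_b − K·W_{bb′}·K`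
  (`K2OfK = −K·dM·K`), the field–field block of `mmRead N (K3OfK …)` has the double-leg `HasSum`
  `R[(dM_b∘K)∘dM_{b′}] + R[(dM_{b′}∘K)∘dM_b] − R[W_{bb′}]`, `R[V] := Σ'_{(y,w)} Σ_{f,g} ρL f · V y w f g · ρR g` — every localisation hypothesis in
  an5's existential currency (`Loc`), supplied from `LocStencil S`, `VertexFamily M`, `BiLoc W` by `loc_dM` (`SecondOrderResponse.vertexFamily_dM`);
* §3 the W-slot instance `K♮_j = unitK s_f s_m (KInvStep Lc j)` at blocking `Lc` (**`hasSum_mmRead_K3OfK_unitKStep`**): `R[V] = −(s_f·s_m·σ_j)² · Σ'_{(y,w)} V y w (inl α) (inl β)`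
  (PART 4's charges + `StepResolventLegCharges.sum_elim_charges`) — the KERNEL-LEG HALF of the zero mode of the value part of the source of record
  `b_j = (cE₂·Lc^{2(d+1)}) • mmRead Lc ∘ K3OfK K♮_j Lc S♮_j M♮_j W♮⁰_j + border` (`W3SourceRows`): what remains for ROW W3-F2a are the BOND sums of three ff
  double-leg sums of localised kernels built from `dM`, `K♮_j`, `W♮⁰_j` ((Q-lin)∕(S2c)∕(S3c) BY NAME).
Asserts NO shape of Bałaban's tables, pins no colour constant, is NOT a W3 row, discharges NOTHING of «T2Shape»∕«T2SupRate»∕(hW, hWall).  NOT «W-slot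
closed», NEVER «G-an2-4 closed»; NOT BetaPertH, NOT continuum, NOT Clay.
-/

noncomputable section

open Finset
open scoped BigOperators
open Literature.MathematicalPhysics.QuantumFieldTheory
open Literature.MathematicalPhysics.QuantumFieldTheory.Balaban1983to89
open Literature.MathematicalPhysics.QuantumFieldTheory.Balaban1983to89.Beta
open B12Sec2to5 (l1)
open ExpKernelCalculus (Site MKer BiLoc Decays VertexFamily comp)
open OneStepResolventKernel (Fib LocStencil biLoc_mono decays_mono)
open OneStepKernelFamily (KInvStep decays_KInvStep)
open SecondOrderResponse (dM K2OfK vertexFamily_dM)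
open BalabanStepW2 (K3OfK)
open BalabanStepJetsSucc (mmRead mmRead_inl_inl)
open Summit.QuantumFields.BalabanUV.Beta.HessKerDressedUnits (unitK decays_unitK)
open Summit.QuantumFields.BalabanUV.Beta.TameKernelCalculus (Spr Loc Tame comp_assoc_tame comp_neg_right)
open Summit.QuantumFields.BalabanUV.Beta.GAN24.ResolventLegCharges (hasSum_sandwich_readout)
open Summit.QuantumFields.BalabanUV.Beta.GAN24.StepResolventLegCharges (hasSum_KInvStep_row hasSum_KInvStep_col hasSum_unitK_row
  hasSum_unitK_col sum_elim_charges)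

namespace Summit.QuantumFields.BalabanUV.Beta.GAN24.ExchangeReadout

variable {d : ℕ}

/-! ## §1 The exchange tree is a sandwich -/

/-- [folklore] **RE-ASSOCIATION OF THE EXCHANGE TREE**: `(K∘P)∘((K∘Q)∘K) = (K∘((P∘K)∘Q))∘K` for a spread `K` and localised `P`, `Q`
(absolutely convergent triple sums; an5's `comp_assoc_tame` three times). -/
theorem exchange_eq_sandwich {K P Q : MKer (d + 1) (Fib d)} (hK : Spr K) (hP : Loc P) (hQ : Loc Q) :
    comp (comp K P) (comp (comp K Q) K) = comp (comp K (comp (comp P K) Q)) K := by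
  have tK : Tame K := hK.tame
  have tP : Tame P := hP.tame
  have tQ : Tame Q := hQ.tame
  have tKP : Tame (comp K P) := (hK.comp_loc hP).tame
  have tKQ : Tame (comp K Q) := (hK.comp_loc hQ).tame
  calc comp (comp K P) (comp (comp K Q) K) = comp (comp (comp K P) (comp K Q)) K := comp_assoc_tame tKP tKQ tK
    _ = comp (comp K (comp P (comp K Q))) K := by rw [← comp_assoc_tame tK tP tKQ]
    _ = comp (comp K (comp (comp P K) Q)) K := by rw [comp_assoc_tame tP tK tQ]

variable {N : ℕ} [NeZero N]

/-- [folklore] **THE EXCHANGE READ-OUT**: for a decaying `K` with site-free coarse-leg charges `ρL`∕`ρR` against `inr α`∕`inr β` and localised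
`P`, `Q`, the `mm`-entries of `K∘P∘K∘Q∘K` at the coarse points have the double-leg `HasSum` `Σ'_{(y,w)} Σ_{f,g} ρL f · ((P∘K)∘Q) y w f g · ρR g`. -/
theorem hasSum_exchange_readout {K P Q : MKer (d + 1) (Fib d)} {C δ : ℝ} (hK : Decays K C δ) (hδ : 0 < δ) (hP : Loc P) (hQ : Loc Q)
    (α β : Fin (d + 1)) {ρL ρR : Fib d → ℝ}
    (hrow : ∀ f y, HasSum (fun x' : Site (d + 1) => K ((N : ℤ) • x') y (Sum.inr α) f) (ρL f))
    (hcol : ∀ g w, HasSum (fun z' : Site (d + 1) => K w ((N : ℤ) • z') g (Sum.inr β)) (ρR g)) :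
    HasSum (fun xz : Site (d + 1) × Site (d + 1) =>
        comp (comp K P) (comp (comp K Q) K) ((N : ℤ) • xz.1) ((N : ℤ) • xz.2) (Sum.inr α) (Sum.inr β))
      (∑' yw : Site (d + 1) × Site (d + 1), ∑ f, ∑ g, ρL f * comp (comp P K) Q yw.1 yw.2 f g * ρR g) := by
  have hKs : Spr K := ⟨C, δ, hδ, hK⟩
  obtain ⟨p, q, Cv, δv, hδv, hV⟩ := (hP.comp_spr hKs).comp hQ
  rw [exchange_eq_sandwich hKs hP hQ]
  exact hasSum_sandwich_readout hK hδ hV hδv α β hrow hcol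

/-! ## §2 The read-out of `K3OfK` -/

omit [NeZero N] in
/-- [folklore] `K2OfK` is minus a sandwich, as a kernel. -/
theorem K2OfK_eq_neg (K : MKer (d + 1) (Fib d)) (S M : Fin (d + 1) → Site (d + 1) → MKer (d + 1) (Fib d)) (ν : Fin (d + 1))
    (y' : Site (d + 1)) : K2OfK K N S M ν y' = -comp (comp K (dM K N S M ν y')) K := rfl

omit [NeZero N] in
/-- [folklore] `K3OfK` entrywise as two exchange trees minus the `K·W·K` sandwich (the two `K2OfK` signs resolved). -/
theorem K3OfK_apply_eq (K : MKer (d + 1) (Fib d)) (S M : Fin (d + 1) → Site (d + 1) → MKer (d + 1) (Fib d))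
    (W : Fin (d + 1) → Site (d + 1) → Fin (d + 1) → Site (d + 1) → MKer (d + 1) (Fib d)) (μ : Fin (d + 1)) (y : Site (d + 1))
    (ν : Fin (d + 1)) (y' : Site (d + 1)) (x z : Site (d + 1)) (a b : Fib d) :
    K3OfK K N S M W μ y ν y' x z a b =
      comp (comp K (dM K N S M μ y)) (comp (comp K (dM K N S M ν y')) K) x z a b +
        comp (comp K (dM K N S M ν y')) (comp (comp K (dM K N S M μ y)) K) x z a b -
          comp (comp K (W μ y ν y')) K x z a b := by
  simp only [K3OfK]
  rw [K2OfK_eq_neg, K2OfK_eq_neg, comp_neg_right, comp_neg_right]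
  simp only [Pi.neg_apply]
  ring

/-- [folklore] The Lagrangian-chart background derivative `dM K N S M μ y` is LOCALISED (an5's existential currency) for a decaying `K`, a local
stencil family `S` and a vertex family `M` (`SecondOrderResponse.vertexFamily_dM` at the common rate). -/
theorem loc_dM {K : MKer (d + 1) (Fib d)} {C δ : ℝ} (hK : Decays K C δ) (hδ : 0 < δ)
    {S : Fin (d + 1) → Site (d + 1) → MKer (d + 1) (Fib d)} {Cs δs : ℝ} (hS : LocStencil S Cs δs) (hδs : 0 < δs)
    {M : Fin (d + 1) → Site (d + 1) → MKer (d + 1) (Fib d)} {CM δM : ℝ} (hM : VertexFamily M N CM δM) (hδM : 0 < δM)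
    (μ : Fin (d + 1)) (y : Site (d + 1)) : Loc (dM K N S M μ y) := by
  have hC : 0 ≤ C := hK.nonneg (Sum.inl 0)
  have hCs : 0 ≤ Cs := (hS 0 0).nonneg (Sum.inl 0)
  have hCM : 0 ≤ CM := (hM 0 0).nonneg (Sum.inl 0)
  set m : ℝ := min δ (min δs δM) with hm
  have hm0 : 0 < m := lt_min hδ (lt_min hδs hδM)
  have hS' : LocStencil S Cs m := fun κ u => biLoc_mono (hS κ u) hCs ((min_le_right _ _).trans (min_le_left _ _))
  have hM' : VertexFamily M N CM m := fun ρ w => biLoc_mono (hM ρ w) hCM ((min_le_right _ _).trans (min_le_right _ _))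
  have h := vertexFamily_dM (N := N) hK hC hS' hM' hm0 (min_le_left _ _) μ y
  exact ⟨_, _, _, m / 2, half_pos hm0, h⟩

/-- [folklore] **THE READ-OUT OF `K3OfK`**: with `R[V] := Σ'_{(y,w)} Σ_{f,g} ρL f · V y w f g · ρR g`, the field–field block of
`mmRead N (K3OfK K N S M W μ y ν y′)` has the double-leg `HasSum` `R[(dM_b∘K)∘dM_{b′}] + R[(dM_{b′}∘K)∘dM_b] − R[W_{bb′}]`. -/
theorem hasSum_mmRead_K3OfK {K : MKer (d + 1) (Fib d)} {C δ : ℝ} (hK : Decays K C δ) (hδ : 0 < δ)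
    {S M : Fin (d + 1) → Site (d + 1) → MKer (d + 1) (Fib d)}
    {W : Fin (d + 1) → Site (d + 1) → Fin (d + 1) → Site (d + 1) → MKer (d + 1) (Fib d)} {μ ν : Fin (d + 1)} {y y' : Site (d + 1)}
    (hb : Loc (dM K N S M μ y)) (hb' : Loc (dM K N S M ν y')) (hW : Loc (W μ y ν y')) (α β : Fin (d + 1)) {ρL ρR : Fib d → ℝ}
    (hrow : ∀ f w, HasSum (fun x' : Site (d + 1) => K ((N : ℤ) • x') w (Sum.inr α) f) (ρL f))
    (hcol : ∀ g w, HasSum (fun z' : Site (d + 1) => K w ((N : ℤ) • z') g (Sum.inr β)) (ρR g)) :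
    HasSum (fun xz : Site (d + 1) × Site (d + 1) => mmRead N (K3OfK K N S M W μ y ν y') xz.1 xz.2 (Sum.inl α) (Sum.inl β))
      ((∑' yw : Site (d + 1) × Site (d + 1), ∑ f, ∑ g,
          ρL f * comp (comp (dM K N S M μ y) K) (dM K N S M ν y') yw.1 yw.2 f g * ρR g) +
        (∑' yw : Site (d + 1) × Site (d + 1), ∑ f, ∑ g,
          ρL f * comp (comp (dM K N S M ν y') K) (dM K N S M μ y) yw.1 yw.2 f g * ρR g) -
        ∑' yw : Site (d + 1) × Site (d + 1), ∑ f, ∑ g, ρL f * W μ y ν y' yw.1 yw.2 f g * ρR g) := by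
  obtain ⟨p, q, Cw, δw, hδw, hWb⟩ := hW
  have h1 := hasSum_exchange_readout (N := N) hK hδ hb hb' α β hrow hcol
  have h2 := hasSum_exchange_readout (N := N) hK hδ hb' hb α β hrow hcol
  have h3 := hasSum_sandwich_readout (N := N) hK hδ hWb hδw α β hrow hcol
  refine ((h1.add h2).sub h3).congr_fun fun xz => ?_
  rw [mmRead_inl_inl, K3OfK_apply_eq]

/-! ## §3 The W-slot instance: `K♮_j = unitK s_f s_m (KInvStep Lc j)` at blocking `Lc` -/

section Step

variable {Lc : ℕ} [NeZero Lc]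

/-- [folklore] **THE READ-OUT OF `K3OfK` THROUGH THE NORMALISED STEP KERNEL**: for `K♮_j = unitK s_f s_m (KInvStep Lc j)`, localised `dM_b`, `dM_{b′}`,
`W_{bb′}`, the field–field block of `mmRead Lc (K3OfK K♮_j Lc S M W b b′)` has the double-leg `HasSum`
`−(s_f·s_m·σ_j)² · ( Σ' [(dM_b∘K♮_j)∘dM_{b′}]_ff + Σ' [(dM_{b′}∘K♮_j)∘dM_b]_ff − Σ' [W_{bb′}]_ff )`, `σ_j = (Lc^{j+1})^{−(d+2)}` — every level `j`, all units. -/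
theorem hasSum_mmRead_K3OfK_unitKStep (sf sm : ℝ) (j : ℕ) {S M : Fin (d + 1) → Site (d + 1) → MKer (d + 1) (Fib d)}
    {W : Fin (d + 1) → Site (d + 1) → Fin (d + 1) → Site (d + 1) → MKer (d + 1) (Fib d)} {μ ν : Fin (d + 1)} {y y' : Site (d + 1)}
    (hb : Loc (dM (unitK sf sm (KInvStep (d := d) Lc j)) Lc S M μ y)) (hb' : Loc (dM (unitK sf sm (KInvStep (d := d) Lc j)) Lc S M ν y'))
    (hW : Loc (W μ y ν y')) (α β : Fin (d + 1)) :
    HasSum (fun xz : Site (d + 1) × Site (d + 1) =>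
        mmRead Lc (K3OfK (unitK sf sm (KInvStep (d := d) Lc j)) Lc S M W μ y ν y') xz.1 xz.2 (Sum.inl α) (Sum.inl β))
      (-((sf * sm * ((((Lc ^ (j + 1) : ℕ) : ℝ)) ^ (d + 1 + 1))⁻¹) * (sf * sm * ((((Lc ^ (j + 1) : ℕ) : ℝ)) ^ (d + 1 + 1))⁻¹)) *
        ((∑' yw : Site (d + 1) × Site (d + 1), comp (comp (dM (unitK sf sm (KInvStep (d := d) Lc j)) Lc S M μ y)
            (unitK sf sm (KInvStep (d := d) Lc j))) (dM (unitK sf sm (KInvStep (d := d) Lc j)) Lc S M ν y') yw.1 yw.2 (Sum.inl α) (Sum.inl β)) +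
          (∑' yw : Site (d + 1) × Site (d + 1), comp (comp (dM (unitK sf sm (KInvStep (d := d) Lc j)) Lc S M ν y')
            (unitK sf sm (KInvStep (d := d) Lc j))) (dM (unitK sf sm (KInvStep (d := d) Lc j)) Lc S M μ y) yw.1 yw.2 (Sum.inl α) (Sum.inl β)) -
          ∑' yw : Site (d + 1) × Site (d + 1), W μ y ν y' yw.1 yw.2 (Sum.inl α) (Sum.inl β))) := by
  obtain ⟨δ, C, hδ, hC, hK⟩ := decays_KInvStep (d := d) (Lc := Lc) j
  set σ : ℝ := ((((Lc ^ (j + 1) : ℕ) : ℝ)) ^ (d + 1 + 1))⁻¹ with hσ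
  have hKu : Decays (unitK sf sm (KInvStep (d := d) Lc j)) (max |sf| |sm| * C * max |sf| |sm|) δ := decays_unitK hK
  have hrow : ∀ (f : Fib d) (w : Site (d + 1)), HasSum (fun x' : Site (d + 1) =>
      unitK sf sm (KInvStep (d := d) Lc j) (((Lc : ℕ) : ℤ) • x') w (Sum.inr α) f)
      (Sum.elim (fun a => -(if a = α then sm * σ * sf else 0)) (fun _ => (0 : ℝ)) f) := by
    intro f w
    have h := hasSum_unitK_row sf sm (hasSum_KInvStep_row (d := d) (Lc := Lc) j α f w)
    rcases f with a | m
    · simp only [Sum.elim_inl, HessKerDressedUnits.legScale_inl] at h ⊢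
      convert h using 1
      split_ifs <;> ring
    · simp only [Sum.elim_inr, HessKerDressedUnits.legScale_inr, mul_zero, zero_mul] at h ⊢
      exact h
  have hcol : ∀ (g : Fib d) (w : Site (d + 1)), HasSum (fun z' : Site (d + 1) =>
      unitK sf sm (KInvStep (d := d) Lc j) w (((Lc : ℕ) : ℤ) • z') g (Sum.inr β))
      (Sum.elim (fun b => if b = β then sf * σ * sm else 0) (fun _ => (0 : ℝ)) g) := by
    intro g w
    have h := hasSum_unitK_col sf sm (hasSum_KInvStep_col (d := d) (Lc := Lc) j β g w)
    rcases g with b | m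
    · simp only [Sum.elim_inl, HessKerDressedUnits.legScale_inl] at h ⊢
      convert h using 1
      split_ifs <;> ring
    · simp only [Sum.elim_inr, HessKerDressedUnits.legScale_inr, mul_zero, zero_mul] at h ⊢
      exact h
  have h := hasSum_mmRead_K3OfK (N := Lc) hKu hδ hb hb' hW α β hrow hcol
  simp_rw [sum_elim_charges] at h
  rw [tsum_mul_left, tsum_mul_left, tsum_mul_left] at h
  convert h using 1
  ring

end Step

end Summit.QuantumFields.BalabanUV.Beta.GAN24.ExchangeReadout

end
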